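import Mathlib
import HarnessLib

/-!
# Abstract log-linear rigidity — auxiliary lemmas
(stub `stub_abstractLogLinear`, line `ax-schanuel-germs`)

Support for crux `LiouvilleUnfolding.LogPrimitiveNL` (stmt-KontsevichZagierPeriods-2836), helper
file for `LiouvilleUnfoldingLogPrimitiveNLStubAbstractLogLinear.lean`:
* integer coordinates of a finite family over a `ℚ`-linearly independent subfamily
  (`exists_int_coords`, clearing denominators);
* logarithmic derivatives of products of integer powers for an abstract derivation;
* bookkeeping for zero-extensions `Fin.insertNth i 0` of integer vectors;
* the real double-orthogonal lemma for integer vectors (`real_double_orthogonal`, conjunct (2) of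
  the stub): rational reduction of real relations through a `ℚ`-independent family of reals, then
  duality `W = W⁰⁰` in `ℝᵏ` (`Subspace.dualAnnihilator_dualCoannihilator_eq`).
-/

noncomputable section

open Set MeasureTheory Filter
open scoped ContDiff Topology LaurentSeries RatFunc

namespace Summit.KontsevichZagierPeriods.LiouvilleUnfolding.LogPrimitiveNL.AxSchanuelGerms

/-! ## Rational bookkeeping -/

/-- Clearing denominators: finitely many rationals are integers divided by one positive integer. -/
theorem exists_nat_mul_eq_intCast_of_fintype {ι : Type*} [Fintype ι] (q : ι → ℚ) :
    ∃ (N : ℕ) (m : ι → ℤ), 0 < N ∧ ∀ i, (N : ℚ) * q i = m i := by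
  classical
  refine ⟨∏ j, (q j).den, fun i => ((∏ j, (q j).den) / (q i).den : ℕ) * (q i).num, ?_, fun i => ?_⟩
  · exact Finset.prod_pos fun j _ => (q j).den_pos
  · have hdvd : (q i).den ∣ ∏ j, (q j).den := Finset.dvd_prod_of_mem _ (Finset.mem_univ i)
    have e1 : ((∏ j, (q j).den : ℕ) : ℚ) =
        (((∏ j, (q j).den) / (q i).den : ℕ) : ℚ) * (q i).den := by
      rw [← Nat.cast_mul, Nat.div_mul_cancel hdvd]
    rw [e1, mul_assoc, mul_comm ((q i).den : ℚ) (q i), Rat.mul_den_eq_num]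
    simp only [Int.cast_mul, Int.cast_natCast]

/-- Integer coordinates: a finite family in a field of characteristic zero, multiplied by a positive
integer, is an integer combination of a `ℚ`-linearly independent subfamily. -/
theorem exists_int_coords {K : Type*} [Field K] [CharZero K] {k : ℕ} (c : Fin k → K) :
    ∃ (m : ℕ) (e : Fin m → K) (n : Fin k → Fin m → ℤ) (N : ℕ), 0 < N ∧ LinearIndependent ℚ e ∧
      (∀ t, ∃ i, e t = c i) ∧ ∀ i, (N : K) * c i = ∑ t, (n i t : K) * e t := by
  classical
  obtain ⟨κ, a, ha, hspan, hli⟩ := exists_linearIndependent' (K := ℚ) c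
  haveI : Finite κ := Finite.of_injective a ha
  letI : Fintype κ := Fintype.ofFinite κ
  set σ := Fintype.equivFin κ
  set e : Fin (Fintype.card κ) → K := c ∘ a ∘ σ.symm with he
  have hrange : Set.range e = Set.range (c ∘ a) := by
    rw [he, ← Function.comp_assoc]
    exact σ.symm.surjective.range_comp _
  have hmem : ∀ i, c i ∈ Submodule.span ℚ (Set.range e) := fun i => by
    rw [hrange, hspan]
    exact Submodule.subset_span (Set.mem_range_self i)
  choose q hq using fun i => (Submodule.mem_span_range_iff_exists_fun ℚ).mp (hmem i)
  obtain ⟨N, nn, hN, hnn⟩ :=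
    exists_nat_mul_eq_intCast_of_fintype fun it : Fin k × Fin (Fintype.card κ) => q it.1 it.2
  refine ⟨Fintype.card κ, e, fun i t => nn (i, t), N, hN, hli.comp σ.symm σ.symm.injective,
    fun t => ⟨a (σ.symm t), rfl⟩, fun i => ?_⟩
  calc (N : K) * c i = (N : K) * ∑ t, q i t • e t := by rw [hq]
    _ = ∑ t, (((N : ℚ) * q i t : ℚ) : K) * e t := by
        rw [Finset.mul_sum]
        refine Finset.sum_congr rfl fun t _ => ?_
        rw [Rat.smul_def]; push_cast; ring
    _ = ∑ t, (nn (i, t) : K) * e t := by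
        refine Finset.sum_congr rfl fun t _ => ?_
        rw [hnn (i, t)]; push_cast; rfl

/-! ## Logarithmic derivatives of products of integer powers -/

section Deriv

variable {L : Type*} [Field L] (D : Derivation ℤ L L)

/-- Logarithmic derivative of an integer power: `(a ^ n)⁻¹ D (a ^ n) = n a⁻¹ D a` (`a ≠ 0`). -/
theorem inv_mul_deriv_zpow (a : L) (ha : a ≠ 0) (n : ℤ) :
    (a ^ n)⁻¹ * D (a ^ n) = (n : L) * (a⁻¹ * D a) := by
  letI : Differential L := ⟨D⟩
  have key : Differential.logDeriv (a ^ n) = (n : L) * Differential.logDeriv a := by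
    cases n with
    | ofNat m => simp [Differential.logDeriv_pow]
    | negSucc m =>
      rw [zpow_negSucc, inv_eq_one_div,
        Differential.logDeriv_div _ _ one_ne_zero (pow_ne_zero _ ha),
        Differential.logDeriv_one, Differential.logDeriv_pow, Int.cast_negSucc]
      push_cast; ring
  simp only [Differential.logDeriv, div_eq_mul_inv] at key
  change D (a ^ n) * (a ^ n)⁻¹ = (n : L) * (D a * a⁻¹) at key
  rw [mul_comm, key]; ring

/-- Logarithmic derivative of a product of integer powers of non-zero elements. -/
theorem inv_mul_deriv_prod_zpow {ι : Type*} [Fintype ι] (w : ι → L) (hw : ∀ i, w i ≠ 0)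
    (n : ι → ℤ) :
    (∏ i, w i ^ n i)⁻¹ * D (∏ i, w i ^ n i) = ∑ i, (n i : L) * ((w i)⁻¹ * D (w i)) := by
  letI : Differential L := ⟨D⟩
  have key : Differential.logDeriv (∏ i, w i ^ n i) = ∑ i, Differential.logDeriv (w i ^ n i) :=
    Differential.logDeriv_prod ι Finset.univ (fun i => w i ^ n i)
      fun i _ => zpow_ne_zero _ (hw i)
  have e1 : ∀ x : L, Differential.logDeriv x = x⁻¹ * D x := fun x => by
    simp only [Differential.logDeriv, div_eq_mul_inv]
    change D x * x⁻¹ = _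
    rw [mul_comm]
  simp only [e1] at key
  rw [key]
  exact Finset.sum_congr rfl fun i _ => inv_mul_deriv_zpow D (w i) (hw i) (n i)

/-- `D (n * y) = n * D y` for an integer `n`. -/
theorem deriv_intCast_mul (n : ℤ) (y : L) : D ((n : L) * y) = (n : L) * D y := by
  rw [Derivation.leibniz, Derivation.map_intCast, smul_zero, add_zero, smul_eq_mul]

/-- `D (Σ nᵢ yᵢ) = Σ nᵢ D yᵢ` for integers `nᵢ`. -/
theorem deriv_sum_intCast_mul {ι : Type*} (s : Finset ι) (n : ι → ℤ) (y : ι → L) :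
    D (∑ i ∈ s, (n i : L) * y i) = ∑ i ∈ s, (n i : L) * D (y i) := by
  rw [map_sum]
  exact Finset.sum_congr rfl fun i _ => deriv_intCast_mul D (n i) (y i)

end Deriv

/-! ## Zero-extensions of integer vectors -/

/-- Zero-extension at `i` of an integer vector pairs with `y` as the vector pairs with
`y ∘ i.succAbove`. -/
theorem sum_cast_insertNth_mul {R : Type*} [Ring R] {k : ℕ} (i : Fin (k + 1)) (f : Fin k → ℤ)
    (y : Fin (k + 1) → R) :
    ∑ l, ((Fin.insertNth i (0 : ℤ) f : Fin (k + 1) → ℤ) l : R) * y l =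
      ∑ j, (f j : R) * y (i.succAbove j) := by
  rw [Fin.sum_univ_succAbove _ i, Fin.insertNth_apply_same]
  simp only [Fin.insertNth_apply_succAbove, Int.cast_zero, zero_mul, zero_add]

/-- Integer pairing with a zero-extension at `i`. -/
theorem sum_mul_insertNth {k : ℕ} (i : Fin (k + 1)) (f : Fin k → ℤ) (p : Fin (k + 1) → ℤ) :
    ∑ l, p l * (Fin.insertNth i (0 : ℤ) f : Fin (k + 1) → ℤ) l = ∑ j, p (i.succAbove j) * f j := by
  rw [Fin.sum_univ_succAbove _ i, Fin.insertNth_apply_same]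
  simp only [Fin.insertNth_apply_succAbove, mul_zero, zero_add]

/-! ## Part 2: the real double-orthogonal lemma for integer vectors -/

section PartTwo

/-- **Rational reduction**: a real vector orthogonal to every INTEGER vector orthogonal to `S ⊆ ℤᵏ`
is orthogonal to every REAL vector orthogonal to `S` (integer coordinates of the real vector over a
`ℚ`-independent family of reals: each coordinate column is an integer vector orthogonal to `S`). -/
theorem real_orth_of_int_orth {k : ℕ} (S : Set (Fin k → ℤ)) (v : Fin k → ℝ)
    (hv : ∀ p : Fin k → ℤ, (∀ f ∈ S, ∑ i, p i * f i = 0) → ∑ i, (p i : ℝ) * v i = 0)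
    (μ : Fin k → ℝ) (hμ : ∀ f ∈ S, ∑ i, μ i * f i = 0) : ∑ i, μ i * v i = 0 := by
  obtain ⟨m, r, n, N, hN, hli, -, hμr⟩ := exists_int_coords μ
  -- expansion of `N (μ ⬝ x)` along the `rₜ`
  have hexp : ∀ x : Fin k → ℝ,
      (N : ℝ) * ∑ i, μ i * x i = ∑ t, r t * ∑ i, (n i t : ℝ) * x i := fun x => by
    rw [Finset.mul_sum]
    simp_rw [← mul_assoc, hμr]
    simp only [Finset.sum_mul, Finset.mul_sum]
    rw [Finset.sum_comm]
    exact Finset.sum_congr rfl fun t _ => Finset.sum_congr rfl fun i _ => by ring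
  -- each column of `n` is an integer vector orthogonal to `S`
  have hcol : ∀ t, ∀ f ∈ S, ∑ i, n i t * f i = 0 := fun t f hf => by
    have h1 : ∑ t', ((∑ i, n i t' * f i : ℤ) : ℚ) • r t' = 0 := by
      have h2 := hexp fun i => (f i : ℝ)
      rw [hμ f hf, mul_zero] at h2
      rw [h2]
      refine Finset.sum_congr rfl fun t' _ => ?_
      rw [Rat.smul_def, mul_comm]
      push_cast
      rfl
    have := Fintype.linearIndependent_iff.mp hli _ h1 t
    exact_mod_cast this
  have h3 := hexp v
  simp only [fun t => hv _ (hcol t), mul_zero, Finset.sum_const_zero] at h3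
  exact (mul_eq_zero.mp h3).resolve_left (Nat.cast_ne_zero.mpr hN.ne')

/-- **Duality in `ℝᵏ`**: a vector orthogonal to every real vector orthogonal to `S` lies in the real
span of `S` (`W = W⁰⁰` for a subspace `W`, `Subspace.dualAnnihilator_dualCoannihilator_eq`). -/
theorem mem_span_of_forall_orth {k : ℕ} (S : Set (Fin k → ℤ)) (v : Fin k → ℝ)
    (hv : ∀ μ : Fin k → ℝ, (∀ f ∈ S, ∑ i, μ i * f i = 0) → ∑ i, μ i * v i = 0) :
    v ∈ Submodule.span ℝ {φ : Fin k → ℝ | ∃ f ∈ S, φ = fun i => (f i : ℝ)} := by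
  classical
  rw [← Subspace.dualAnnihilator_dualCoannihilator_eq
    (W := Submodule.span ℝ {φ : Fin k → ℝ | ∃ f ∈ S, φ = fun i => (f i : ℝ)}),
    Submodule.mem_dualCoannihilator]
  intro φ hφ
  rw [Submodule.mem_dualAnnihilator] at hφ
  have hφx : ∀ x : Fin k → ℝ, φ x = ∑ i, (φ fun j => if i = j then 1 else 0) * x i := fun x => by
    rw [LinearMap.pi_apply_eq_sum_univ φ x]
    exact Finset.sum_congr rfl fun i _ => by rw [smul_eq_mul, mul_comm]
  rw [hφx]
  refine hv _ fun f hf => ?_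
  have := hφ (fun i => (f i : ℝ)) (Submodule.subset_span ⟨f, hf, rfl⟩)
  rwa [hφx] at this

end PartTwo

/-- **Real double-orthogonal lemma for integer vectors** (conjunct (2) of `stub_abstractLogLinear`):
for `S ⊆ ℤᵏ`, a real vector orthogonal to every integer vector orthogonal to `S` lies in the real
span of `S`. -/
theorem real_double_orthogonal :
    ∀ (k : ℕ) (S : Set (Fin k → ℤ)) (v : Fin k → ℝ),
      (∀ p : Fin k → ℤ, (∀ f ∈ S, ∑ i, p i * f i = 0) → ∑ i, (p i : ℝ) * v i = 0) →
      v ∈ Submodule.span ℝ {φ : Fin k → ℝ | ∃ f ∈ S, φ = fun i => (f i : ℝ)} :=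
  fun _ S v hv => mem_span_of_forall_orth S v (real_orth_of_int_orth S v hv)

end Summit.KontsevichZagierPeriods.LiouvilleUnfolding.LogPrimitiveNL.AxSchanuelGerms

end
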